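import Summits.ValiantsHypothesis.ValiantsHypothesis.Theorems.KPlusLogSqLawTropicalBToeplitzTilings

/-!
# Route `KPlusLogSqLaw`, crux `TropicalB` — linear Toeplitz instances: the UNIT ROUNDING REGIME carries at most two optima

HONEST FRAMING.  Helper toward the registered stubs `stub_tropThin` / `stub_tropFat` of
`Cruxes/TropicalB/Lines/birth.lean` (crux `Summit.ValiantsHypothesis.ValiantsHypothesis.Theses.KPlusLogSqLaw.TropicalB`,
ledger item `stmt-ValiantsHypothesis-19771`, route `KPlusLogSqLaw`; cell `pub-symmetroid`, seat `val-sym-trop-p3`,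
2026-08-26).  First instance of the ROUNDING regime of the cell's Conjecture T (bound `Φ` on pairwise distinct unique
optima of a LINEAR Toeplitz parametric assignment instance = hypothesis of `toeplitz_chain_le_of_linearBound`,
`…TropicalBToeplitzReduction`; TIGHT slopes are `…TropicalBToeplitzTwoPhase`).  Nothing here bounds `Φ` in general,
nothing bounds `TropicalB` for general designs, and nothing bears on `KPlusLogSqLaw`, `MatrixDescartes` or `VP ≠ VNP`.

THE REGIME.  At a slope `θ` the instance `(ψ, α)` is in the `(1, −1)` regime when a Lagrangian certificate
`δ ↦ L·(θ ψ(δ) + α(δ)) − Λ·δ ≤ Mx` (`L > 0`) holds on all entries with equality at `δ = 1` and at `δ = −1`: the two-point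
relaxation of the Toeplitz assignment problem straddles `0` with the pair `(1, −1)`.  At EVEN size it is tight (the
adjacent-transposition tiling realises it: `toeplitz_unitRegime_even`); at ODD size `2 ∤ m` and no permutation has all
displacements in `{1, −1}` — a ROUNDING slope, the first one in every instance where it occurs.

THE RESULT.  `toeplitz_unitRegime_opt_eq_rotation`: at odd size `n + 1` (`n` even), a permutation that is the unique
maximiser among all permutations at a slope in the `(1, −1)` regime is the ROTATION by `+1` or by `−1`; hence
(`toeplitz_unitRegime_card_le_two`) along any chain at most two indices lie in this regime.  So the unit rounding regime is
as poor as a tight one — and its optima are NOT «blocks plus a local defect» (those tie with their translates) but the two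
rigid global cycles.

THE PROOF (penalty form).  With `pen(δ) = Mx − (L·w_θ(δ) − Λ δ) ≥ 0`, vanishing at `±1`, one has
`L·W_θ(σ) = (n+1)·Mx − Σ_b pen(σ b − b)` (displacements sum to `0`), so the unique maximiser `τ` is the unique minimiser
of the total penalty, and two DISTINCT competitors with the same total penalty `c` force `Pen(τ) < c`; since every term is
`≥ 0`, `Pen(τ) < pen(d)` forbids the displacement `d` in `τ`.  Competitors (explicit permutations, `…TropicalBToeplitzTilings`):
`exists_tiling_fix_first` / `exists_tiling_fix_last` (one fixed point, the rest adjacent transpositions: penalty `pen 0`)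
and, for even `j` with `2 ≤ j ≤ n − 2`, `exists_rotTiling_first` / `exists_rotTiling_last` (a block of length `j + 1`
rotated by `+1` at either end, the rest adjacent transpositions: penalty `pen(−j)`) together with their inverses (penalty
`pen(+j)`).  So `τ` has no displacement `0`, `±2`, …, `±(n−2)`; a displacement `∓n` sits at an end and costs
`pen(∓n) = Pen(rotation by ±1)`, forcing `τ` to be that rotation by uniqueness; otherwise all `n + 1` displacements of `τ`
are odd, and an odd number of odd integers does not sum to `0`.

References: folklore (Lagrangian penalties; domination by equal-penalty pairs; parity); `sum_displacement_eq_zero`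
(`…TropicalBToeplitzAffineWrap`), `toeplitz_twoPhase_opt_eq_of_pair`, `exists_perm_two_displacements`
(`…TropicalBToeplitzTwoPhase`); desk ruling R1427 (c) «next file = rounding slopes».
-/

set_option linter.dupNamespace false
set_option autoImplicit false

namespace Summit.ValiantsHypothesis.ValiantsHypothesis.Theorems.KPlusLogSqLaw

open scoped BigOperators
open Finset

section UnitRegime

variable {n : ℕ}

/-- In `Fin (n+1)`, adding `Fin.last n` (that is, `−1`) to a nonzero element lowers its value by one. [folklore] -/
theorem val_add_last_of_ne_zero (b : Fin (n + 1)) (hb : (b : ℕ) ≠ 0) :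
    ((b + Fin.last n : Fin (n + 1)) : ℕ) = (b : ℕ) - 1 := by
  rw [Fin.val_add, Fin.val_last]
  have hb' := b.isLt
  have : (b : ℕ) + n = ((b : ℕ) - 1) + (n + 1) := by omega
  rw [this, Nat.add_mod_right, Nat.mod_eq_of_lt (by omega)]

/-- **The unit rounding regime of a linear Toeplitz instance (odd size): a unique optimum is a unit rotation.**
Size `n + 1` with `n` EVEN.  Suppose the slope `θ` lies in the `(1, −1)` regime: for some `L > 0`, `Λ`, `Mx` the Lagrangian
function `δ ↦ L·(θ ψ(δ) + α(δ)) − Λ·δ` is `≤ Mx` on every entry and `= Mx` at `δ = 1` and at `δ = −1` (the two-point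
relaxation straddles `0` with the pair `(1, −1)`; since `2 ∤ n + 1` no permutation has all displacements in `{1, −1}`:
a ROUNDING slope).  If `τ` is the unique maximiser of `W_θ` among all permutations, then `τ` is the rotation by `+1` or
the rotation by `−1`.  Proof: penalties `pen = Mx − (L w − Λ δ) ≥ 0` vanish at `±1` and `L·W = (n+1)·Mx − Σ pen`, so `τ`
is the unique minimiser of the total penalty; the pairs of distinct equal-penalty competitors `exists_tiling_fix_first` /
`exists_tiling_fix_last` (penalty `pen 0`) and `exists_rotTiling_first` / `exists_rotTiling_last` and their inverses
(penalty `pen (∓j)`, `j` even, `2 ≤ j ≤ n − 2`) forbid the displacements `0` and `∓j` in `τ`; a displacement `∓n` forces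
`τ` to be the corresponding unit rotation (same penalty, uniqueness); otherwise all `n + 1` displacements of `τ` are odd
and cannot sum to `0`. [folklore] -/
theorem toeplitz_unitRegime_opt_eq_rotation (hn : Even n) (ψ α : ℤ → ℤ) (θ L Λ Mx : ℤ) (hL : 0 < L)
    (hmax : ∀ a b : Fin (n + 1), L * (θ * ψ ((a : ℤ) - b) + α ((a : ℤ) - b)) - Λ * ((a : ℤ) - b) ≤ Mx)
    (h1 : L * (θ * ψ 1 + α 1) - Λ * 1 = Mx) (h1' : L * (θ * ψ (-1) + α (-1)) - Λ * (-1) = Mx)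
    (τ : Equiv.Perm (Fin (n + 1)))
    (huniq : ∀ σ : Equiv.Perm (Fin (n + 1)), σ ≠ τ →
      ∑ b, (θ * ψ ((σ b : ℤ) - b) + α ((σ b : ℤ) - b)) < ∑ b, (θ * ψ ((τ b : ℤ) - b) + α ((τ b : ℤ) - b))) :
    τ = Equiv.addRight 1 ∨ τ = Equiv.addRight (Fin.last n) := by
  rcases Nat.eq_zero_or_pos n with hn0 | hnpos
  · subst hn0
    left
    exact Equiv.ext fun b => Fin.ext (by
      have h1 := (τ b).isLt
      have h2 := ((Equiv.addRight (1 : Fin (0 + 1))) b).isLt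
      omega)
  have h2n : 2 ≤ n := by obtain ⟨k, hk⟩ := hn; omega
  -- the penalty
  set pen : ℤ → ℤ := fun δ => Mx - (L * (θ * ψ δ + α δ) - Λ * δ) with hpen
  have pen_nonneg : ∀ a b : Fin (n + 1), 0 ≤ pen ((a : ℤ) - b) := by
    intro a b; simp only [hpen]; linarith [hmax a b]
  have pen_one : pen 1 = 0 := by simp only [hpen]; linarith
  have pen_neg_one : pen (-1) = 0 := by simp only [hpen]; linarith
  -- `L · W σ = (n+1) · Mx − Σ pen`
  have key : ∀ σ : Equiv.Perm (Fin (n + 1)), L * ∑ b, (θ * ψ ((σ b : ℤ) - b) + α ((σ b : ℤ) - b)) =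
      ∑ _b : Fin (n + 1), Mx - ∑ b, pen ((σ b : ℤ) - b) := by
    intro σ
    have h0 := sum_displacement_eq_zero σ
    have e2 : ∀ b : Fin (n + 1), L * (θ * ψ ((σ b : ℤ) - b) + α ((σ b : ℤ) - b)) =
        Mx - pen ((σ b : ℤ) - b) + Λ * ((σ b : ℤ) - b) := fun b => by simp only [hpen]; ring
    rw [mul_sum, sum_congr rfl (fun b _ => e2 b), sum_add_distrib, sum_sub_distrib, ← mul_sum, h0, mul_zero,
      add_zero]
  -- `τ` is the unique minimiser of the total penalty
  have hPen : ∀ σ : Equiv.Perm (Fin (n + 1)), σ ≠ τ →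
      ∑ b, pen ((τ b : ℤ) - b) < ∑ b, pen ((σ b : ℤ) - b) := by
    intro σ hσ
    have h := mul_lt_mul_of_pos_left (huniq σ hσ) hL
    rw [key σ, key τ] at h
    linarith
  have hPen_ge : ∀ b, pen ((τ b : ℤ) - b) ≤ ∑ b, pen ((τ b : ℤ) - b) :=
    fun b => single_le_sum (f := fun b => pen ((τ b : ℤ) - b)) (fun b _ => pen_nonneg (τ b) b) (mem_univ b)
  -- two distinct competitors with the same penalty `c` force `Pen τ < c`
  have hdom : ∀ σ₁ σ₂ : Equiv.Perm (Fin (n + 1)), σ₁ ≠ σ₂ →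
      ∑ b, pen ((σ₁ b : ℤ) - b) = ∑ b, pen ((σ₂ b : ℤ) - b) →
      ∑ b, pen ((τ b : ℤ) - b) < ∑ b, pen ((σ₁ b : ℤ) - b) := by
    intro σ₁ σ₂ hne heq
    by_cases h : σ₁ = τ
    · subst h
      have := hPen σ₂ (Ne.symm hne)
      rw [← heq] at this
      exact absurd this (lt_irrefl _)
    · exact hPen σ₁ h
  -- penalty of a permutation with all but one displacement in `{1, −1}`
  have pen_pm : ∀ x : ℤ, (x = 1 ∨ x = -1) → pen x = 0 := by
    rintro x (rfl | rfl)
    · exact pen_one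
    · exact pen_neg_one
  have pen_single : ∀ (σ : Equiv.Perm (Fin (n + 1))) (b₀ : Fin (n + 1)),
      (∀ b : Fin (n + 1), b ≠ b₀ → ((σ b : ℤ) - b = 1 ∨ (σ b : ℤ) - b = -1)) →
      ∑ b, pen ((σ b : ℤ) - b) = pen ((σ b₀ : ℤ) - b₀) := by
    intro σ b₀ h
    exact sum_eq_single_of_mem b₀ (mem_univ _) fun b _ hb => pen_pm _ (h b hb)
  -- penalty of the inverse permutation: displacements are negated
  have pen_inv : ∀ σ : Equiv.Perm (Fin (n + 1)),
      ∑ b, pen ((σ.symm b : ℤ) - b) = ∑ a, pen (-((σ a : ℤ) - a)) := by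
    intro σ
    rw [← Equiv.sum_comp σ (fun b => pen ((σ.symm b : ℤ) - b))]
    exact sum_congr rfl fun a _ => by rw [Equiv.symm_apply_apply]; ring_nf
  have pen_single_inv : ∀ (σ : Equiv.Perm (Fin (n + 1))) (b₀ : Fin (n + 1)),
      (∀ b : Fin (n + 1), b ≠ b₀ → ((σ b : ℤ) - b = 1 ∨ (σ b : ℤ) - b = -1)) →
      ∑ b, pen ((σ.symm b : ℤ) - b) = pen (-((σ b₀ : ℤ) - b₀)) := by
    intro σ b₀ h
    rw [pen_inv]
    refine sum_eq_single_of_mem b₀ (mem_univ _) fun b _ hb => pen_pm _ ?_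
    rcases h b hb with e | e <;> rw [e] <;> norm_num
  -- STEP 1: displacement `0` is forbidden
  have no_zero : ∀ b, (τ b : ℤ) - b ≠ 0 := by
    obtain ⟨σ₁, h₁0, h₁⟩ := exists_tiling_fix_first hn
    obtain ⟨σ₂, h₂n, h₂⟩ := exists_tiling_fix_last hn
    have hP1 : ∑ b, pen ((σ₁ b : ℤ) - b) = pen 0 := by
      rw [pen_single σ₁ 0 fun b hb => h₁ b (fun h => hb (Fin.ext h))]
      simp [h₁0]
    have hP2 : ∑ b, pen ((σ₂ b : ℤ) - b) = pen 0 := by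
      rw [pen_single σ₂ (Fin.last n) fun b hb => h₂ b (fun h => hb (Fin.ext (by rw [h, Fin.val_last])))]
      simp [h₂n, Fin.val_last]
    have hne : σ₁ ≠ σ₂ := by
      intro h
      have e := h₂ 0 (by simp; omega)
      rw [← h] at e
      simp [h₁0] at e
    have hlt := hdom σ₁ σ₂ hne (hP1.trans hP2.symm)
    rw [hP1] at hlt
    intro b hb
    have := hPen_ge b
    rw [hb] at this
    linarith
  -- STEP 2: even displacements `−j`, `+j` with `2 ≤ j ≤ n − 2` are forbidden
  have no_even : ∀ j : ℕ, Even j → 2 ≤ j → j + 2 ≤ n →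
      ∀ b, (τ b : ℤ) - b ≠ -(j : ℤ) ∧ (τ b : ℤ) - b ≠ (j : ℤ) := by
    intro j hj h2j hjn
    obtain ⟨σ₁, h₁j, h₁⟩ := exists_rotTiling_first hn hj h2j hjn
    obtain ⟨σ₂, h₂n, h₂⟩ := exists_rotTiling_last hn hj h2j hjn
    let bj : Fin (n + 1) := ⟨j, by omega⟩
    have hne : σ₁ ≠ σ₂ := by
      intro h
      have e := h₂ bj (by simp [bj]; omega)
      rw [← h] at e
      have := h₁j bj rfl
      simp [this, bj] at e
      omega
    have hP1 : ∑ b, pen ((σ₁ b : ℤ) - b) = pen (-(j : ℤ)) := by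
      rw [pen_single σ₁ bj fun b hb => h₁ b (fun h => hb (Fin.ext h))]
      rw [h₁j bj rfl]
      simp [bj]
    have hP2 : ∑ b, pen ((σ₂ b : ℤ) - b) = pen (-(j : ℤ)) := by
      rw [pen_single σ₂ (Fin.last n) fun b hb => h₂ b (fun h => hb (Fin.ext (by rw [h, Fin.val_last])))]
      rw [h₂n, Fin.val_last]
      push_cast [show j ≤ n by omega]
      ring_nf
    have hP1' : ∑ b, pen ((σ₁.symm b : ℤ) - b) = pen (j : ℤ) := by
      rw [pen_single_inv σ₁ bj fun b hb => h₁ b (fun h => hb (Fin.ext h)), h₁j bj rfl]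
      simp [bj]
    have hP2' : ∑ b, pen ((σ₂.symm b : ℤ) - b) = pen (j : ℤ) := by
      rw [pen_single_inv σ₂ (Fin.last n) fun b hb => h₂ b (fun h => hb (Fin.ext (by rw [h, Fin.val_last]))),
        h₂n, Fin.val_last]
      push_cast [show j ≤ n by omega]
      ring_nf
    have hne' : σ₁.symm ≠ σ₂.symm := fun h => hne (by simpa using congrArg Equiv.symm h)
    have hlt := hdom σ₁ σ₂ hne (hP1.trans hP2.symm)
    have hlt' := hdom σ₁.symm σ₂.symm hne' (hP1'.trans hP2'.symm)
    rw [hP1] at hlt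
    rw [hP1'] at hlt'
    intro b
    constructor
    · intro hb; have := hPen_ge b; rw [hb] at this; linarith
    · intro hb; have := hPen_ge b; rw [hb] at this; linarith
  -- STEP 3: a displacement `−n` (at the last position) forces the rotation by `+1`
  by_cases hA : ((τ (Fin.last n) : Fin (n + 1)) : ℕ) = 0
  · left
    by_contra hne
    have hρ : ∑ b, pen (((Equiv.addRight (1 : Fin (n + 1)) b : Fin (n + 1)) : ℤ) - b) = pen (-(n : ℤ)) := by
      rw [pen_single (Equiv.addRight 1) (Fin.last n) fun b hb => ?_]
      · simp [Fin.last_add_one, Fin.val_last]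
      · left
        rw [Equiv.coe_addRight, Fin.val_add_one_of_lt (lt_of_le_of_ne (Fin.le_last b) hb)]
        push_cast; ring
    have hlt := hPen (Equiv.addRight 1) (Ne.symm hne)
    have hge := hPen_ge (Fin.last n)
    rw [Fin.val_last, hA] at hge
    simp only [CharP.cast_eq_zero, zero_sub] at hge
    rw [hρ] at hlt
    linarith
  -- STEP 4: a displacement `+n` (at position `0`) forces the rotation by `−1`
  by_cases hB : ((τ 0 : Fin (n + 1)) : ℕ) = n
  · right
    by_contra hne
    have hρ : ∑ b, pen (((Equiv.addRight (Fin.last n) b : Fin (n + 1)) : ℤ) - b) = pen (n : ℤ) := by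
      rw [pen_single (Equiv.addRight (Fin.last n)) 0 fun b hb => ?_]
      · simp [Fin.val_last]
      · right
        have hb' : (b : ℕ) ≠ 0 := fun h => hb (Fin.ext h)
        rw [Equiv.coe_addRight, val_add_last_of_ne_zero b hb']
        have : 1 ≤ (b : ℕ) := Nat.one_le_iff_ne_zero.mpr hb'
        push_cast [this]; ring
    have hlt := hPen (Equiv.addRight (Fin.last n)) (Ne.symm hne)
    have hge := hPen_ge 0
    rw [hB] at hge
    simp only [Fin.val_zero, CharP.cast_eq_zero, sub_zero] at hge
    rw [hρ] at hlt
    linarith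
  -- STEP 5: otherwise every displacement is odd, and `n + 1` odd numbers do not sum to `0`
  exfalso
  have hodd : ∀ b, ((τ b : ℤ) - b) % 2 = 1 := by
    intro b
    rcases Int.emod_two_eq_zero_or_one ((τ b : ℤ) - b) with he | ho
    · exfalso
      -- `d` is even, in `[−n, n]`, nonzero, not `±n`: so `2 ≤ |d| ≤ n − 2`
      have hτb := (τ b).isLt
      have hbb := b.isLt
      have hz := no_zero b
      have hAn : (τ b : ℤ) - b ≠ -(n : ℤ) := by
        intro h
        have hbn : (b : ℕ) = n := by omega
        have hτ0 : ((τ b : Fin (n + 1)) : ℕ) = 0 := by omega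
        have : b = Fin.last n := Fin.ext (by rw [hbn, Fin.val_last])
        rw [this] at hτ0
        exact hA hτ0
      have hBn : (τ b : ℤ) - b ≠ (n : ℤ) := by
        intro h
        have hb0 : (b : ℕ) = 0 := by omega
        have hτn : ((τ b : Fin (n + 1)) : ℕ) = n := by omega
        have : b = 0 := Fin.ext hb0
        rw [this] at hτn
        exact hB hτn
      -- the even value `j = |d|`
      obtain ⟨k, hk⟩ := hn
      rcases le_or_gt 0 ((τ b : ℤ) - b) with hpos | hneg
      · have hj := (no_even (((τ b : ℤ) - b).toNat) ⟨((τ b : ℤ) - b).toNat / 2, by omega⟩ (by omega) (by omega) b).2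
        exact hj (by omega)
      · have hj := (no_even ((b : ℤ) - (τ b : ℤ)).toNat ⟨((b : ℤ) - (τ b : ℤ)).toNat / 2, by omega⟩ (by omega) (by omega) b).1
        exact hj (by omega)
    · exact ho
  have hsum := sum_displacement_eq_zero τ
  have e : ∑ b, ((τ b : ℤ) - (b : ℤ)) = ∑ b : Fin (n + 1), (2 * (((τ b : ℤ) - b) / 2) + 1) :=
    sum_congr rfl fun b _ => by have := hodd b; omega
  rw [e, sum_add_distrib, ← mul_sum, sum_const, card_univ, Fintype.card_fin] at hsum
  simp only [nsmul_eq_mul, mul_one] at hsum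
  obtain ⟨k, hk⟩ := hn
  push_cast at hsum
  omega

/-- **At most two indices of a chain lie in the unit rounding regime (odd size).**  Along a family `τ` of pairwise
distinct permutations of `Fin (n+1)` (`n` even), each the unique maximiser at its slope `θ' k`, the indices `k` whose slope
carries a `(1, −1)`-regime certificate (a Lagrangian triple as in `toeplitz_unitRegime_opt_eq_rotation`) number at most
`2`: their permutations are unit rotations. [folklore] -/
theorem toeplitz_unitRegime_card_le_two (hn : Even n) (ψ α : ℤ → ℤ) {N : ℕ} (θ' : Fin (N + 1) → ℤ)
    (τ : Fin (N + 1) → Equiv.Perm (Fin (n + 1))) (hinj : Function.Injective τ)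
    (huniq : ∀ k (σ : Equiv.Perm (Fin (n + 1))), σ ≠ τ k →
      ∑ b, (θ' k * ψ ((σ b : ℤ) - b) + α ((σ b : ℤ) - b)) <
        ∑ b, (θ' k * ψ ((τ k b : ℤ) - b) + α ((τ k b : ℤ) - b)))
    (S : Finset (Fin (N + 1)))
    (hS : ∀ k ∈ S, ∃ L Λ Mx : ℤ, 0 < L ∧
      (∀ a b : Fin (n + 1), L * (θ' k * ψ ((a : ℤ) - b) + α ((a : ℤ) - b)) - Λ * ((a : ℤ) - b) ≤ Mx) ∧
      L * (θ' k * ψ 1 + α 1) - Λ * 1 = Mx ∧ L * (θ' k * ψ (-1) + α (-1)) - Λ * (-1) = Mx) :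
    S.card ≤ 2 := by
  classical
  have hsub : S.image τ ⊆ ({Equiv.addRight 1, Equiv.addRight (Fin.last n)} : Finset (Equiv.Perm (Fin (n + 1)))) := by
    intro σ hσ
    obtain ⟨k, hk, rfl⟩ := mem_image.mp hσ
    obtain ⟨L, Λ, Mx, hL, hmax, h1, h1'⟩ := hS k hk
    rcases toeplitz_unitRegime_opt_eq_rotation hn ψ α (θ' k) L Λ Mx hL hmax h1 h1' (τ k) (huniq k) with h | h
    · rw [h]; exact mem_insert_self _ _
    · rw [h]; exact mem_insert_of_mem (mem_singleton_self _)
  calc S.card = (S.image τ).card := (card_image_of_injective S hinj).symm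
    _ ≤ ({Equiv.addRight 1, Equiv.addRight (Fin.last n)} : Finset (Equiv.Perm (Fin (n + 1)))).card :=
        card_le_card hsub
    _ ≤ 2 := card_insert_le _ _

/-- **The unit regime at even size is tight.**  Size `n + 1` with `n` ODD: in the `(1, −1)` regime the adjacent-transposition
tiling exists (`exists_perm_two_displacements`, `ℓ = 2`), so by `toeplitz_twoPhase_opt_eq_of_pair` the unique maximiser
has all its displacements in `{1, −1}` — one permutation for the whole regime. [folklore] -/
theorem toeplitz_unitRegime_even (hn : Odd n) (ψ α : ℤ → ℤ) (θ L Λ Mx : ℤ) (hL : 0 < L)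
    (hmax : ∀ a b : Fin (n + 1), L * (θ * ψ ((a : ℤ) - b) + α ((a : ℤ) - b)) - Λ * ((a : ℤ) - b) ≤ Mx)
    (h1 : L * (θ * ψ 1 + α 1) - Λ * 1 = Mx) (h1' : L * (θ * ψ (-1) + α (-1)) - Λ * (-1) = Mx)
    (τ : Equiv.Perm (Fin (n + 1)))
    (huniq : ∀ σ : Equiv.Perm (Fin (n + 1)), σ ≠ τ →
      ∑ b, (θ * ψ ((σ b : ℤ) - b) + α ((σ b : ℤ) - b)) < ∑ b, (θ * ψ ((τ b : ℤ) - b) + α ((τ b : ℤ) - b))) :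
    ∀ b : Fin (n + 1), (τ b : ℤ) - b = 1 ∨ (τ b : ℤ) - b = -1 := by
  have h2 : 2 ∣ n + 1 := by obtain ⟨k, hk⟩ := hn; exact ⟨k + 1, by omega⟩
  obtain ⟨π, hπ⟩ := exists_perm_two_displacements (m := n + 1) (ℓ := 2) (p := 1) h2 (by norm_num)
  have hπ' : ∀ b : Fin (n + 1), (π b : ℤ) - b = 1 ∨ (π b : ℤ) - b = -1 := by
    intro b; rcases hπ b with h | h
    · left; exact_mod_cast h
    · right; rw [h]; norm_num
  have := toeplitz_twoPhase_opt_eq_of_pair ψ α (fun _ => True) θ L Λ Mx hL (fun a b _ => hmax a b) 1 (-1) h1 h1'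
    π (fun _ => trivial) hπ' τ (fun _ => trivial) (fun σ hσ _ => huniq σ hσ)
  rw [this]
  exact hπ'

end UnitRegime

end Summit.ValiantsHypothesis.ValiantsHypothesis.Theorems.KPlusLogSqLaw
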